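import Literature.AlgebraicGeometry.Modules.PullbackPushforwardTwist
import Mathlib.Algebra.Homology.Additive
import Mathlib.Algebra.Homology.HomologicalComplexLimits
import Mathlib.CategoryTheory.Preadditive.Biproducts
import HarnessLib

/-!
# Naturality of `toPi : g^* g_* F ⟶ ∏_x (τ x)^* F` and its termwise extension to complexes

Research route conditional on HC_CM; not a corollary; Q11.4-sentence-2 already refuted in dim ≥ 3.
(Context: cell pub-hodge-ring2, director-hodge g14 R14.24 ∕ R14.26 (2), seat core-D, «(L4♮)∕(D♮) the NATURAL form of the
decomposition `g^*g_*F ≅ ∐_x τ_x^*F`, typed against `toPi`»; in support of `stmt-HodgeConjecture-26512`; this file closes NO item.)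
General scheme theory continuing `PullbackPushforwardTwist.lean`: any morphism `g : X ⟶ Y`, any family of self-maps
`τ : K → (X ⟶ X)` over `Y` (`τ x ≫ g = g`).

WHAT IS PROVED (sorry-free):
* `toTwist_naturality`, `toPi_naturality` — the comparison maps `toTwist g τ hτ F x : g^*g_*F ⟶ (τ x)^*F` and
  `toPi g τ hτ F : g^*g_*F ⟶ ∏_x (τ x)^*F` are NATURAL in `F`: for `φ : F ⟶ F'`,
  `toPi … F ≫ ∏_x (τ x)^*φ = g^*g_*φ ≫ toPi … F'` (naturality of Mathlib's `pullbackCongr`, `pullbackComp` and of the counit of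
  `g^* ⊣ g_*`; Hartshorne II.5: `f^*`, `f_*` are functors and the adjunction is natural). Packaged as the functor
  `piPullback τ : F ↦ ∏_x (τ x)^*F` and the natural transformation `toPiNatTrans g τ hτ : g_* ⋙ g^* ⟶ piPullback τ`.
* COMPLEX LEVEL (any `HomologicalComplex X.Modules c`; `g_*E•`, `g^*E•`, `(τ x)^*E•` are Mathlib's termwise
  `Functor.mapHomologicalComplex`): `toTwistComplex`, `toPiComplex g τ hτ E : g^*g_*E• ⟶ ∏_x (τ x)^*E•` (the product taken IN
  THE CATEGORY OF COMPLEXES), `toPiComplex_f` (its degree-`i` component is `toPi … (E.X i)` up to the canonical identification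
  `(∏_x K_x)^i ≅ ∏_x K_x^i`), `isIso_toPiComplex_of_isIso_toPi` (termwise isomorphism ⇒ isomorphism of complexes) and
  `nonempty_pullback_pushforward_complex_iso_sigma` (`g^*g_*E• ≅ ∐_x (τ x)^*E•` for finite `K`, finite biproducts of complexes).
  With `isIso_toPi_of_galoisCharts` this is the complex-level form of Mumford's `π^*π_*F ≅ ⊕_{x ∈ K} T_x^*F` for the quotient by a
  free finite group action (Abelian Varieties §7 Thm. 4, §12 Thm. 1), as consumed on bounded complexes of vector bundles.

NOT here: the isomorphism statement itself for a concrete `g` (for an isogeny of complex abelian varieties and the kernel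
translations it is `Literature/AlgebraicGeometry/Motives/AbelianVarietyIsogenyPullbackPushforwardNatural.lean`, built on
`isIso_toPi_of_galoisCharts`); naturality of `toPiComplex` in the complex `E•` (termwise `toPi_naturality`, not needed so far).

References: R. Hartshorne, GTM 52 (1977), II.5 p. 110 (`f^*`, `f_*`, adjunction; additive functors act termwise on complexes,
III.1) [Hartshorne1977]; D. Mumford, *Abelian Varieties* (1970), §7 Thm. 4, §12 Thm. 1 [MumfordAV1970].
-/

noncomputable section

open CategoryTheory CategoryTheory.Limits AlgebraicGeometry TopologicalSpace Opposite

universe u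

namespace Literature.AlgebraicGeometry.Modules

variable {X Y : Scheme.{u}} (g : X ⟶ Y) {K : Type u} (τ : K → (X ⟶ X)) (hτ : ∀ x, τ x ≫ g = g)

/-! ## §1 Naturality in the module -/

section Naturality

/-- **`toTwist … x` as a natural transformation `g_* ⋙ g^* ⟶ (τ x)^*`**: the whiskered composite of `pullbackCongr`,
`pullbackComp⁻¹` and the counit `ε : g_* ⋙ g^* ⟶ 𝟭` of `g^* ⊣ g_*`. [cite: Hartshorne1977, II.5 (p. 110)] -/
def toTwistNatTrans (x : K) :
    Scheme.Modules.pushforward g ⋙ Scheme.Modules.pullback g ⟶ Scheme.Modules.pullback (τ x) :=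
  Functor.whiskerLeft (Scheme.Modules.pushforward g) (Scheme.Modules.pullbackCongr (hτ x).symm).hom ≫
    Functor.whiskerLeft (Scheme.Modules.pushforward g) (Scheme.Modules.pullbackComp (τ x) g).inv ≫
      Functor.whiskerRight (Scheme.Modules.pullbackPushforwardAdjunction g).counit (Scheme.Modules.pullback (τ x))

/-- The components of `toTwistNatTrans … x` are the `toTwist … x`. [cite: Hartshorne1977, II.5 (p. 110)] -/
@[simp]
theorem toTwistNatTrans_app (x : K) (F : X.Modules) : (toTwistNatTrans g τ hτ x).app F = toTwist g τ hτ F x := by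
  simp only [toTwistNatTrans, toTwist, NatTrans.comp_app, Functor.whiskerLeft_app, Functor.whiskerRight_app]
  rfl

variable {F F' : X.Modules} (φ : F ⟶ F')

/-- **`toTwist` is natural in `F`**: for `φ : F ⟶ F'`, `toTwist … F x ≫ (τ x)^*φ = g^*g_*φ ≫ toTwist … F' x` (naturality of
`pullbackCongr`, `pullbackComp` and of the counit `ε : g_* ⋙ g^* ⟶ 𝟭`). [cite: Hartshorne1977, II.5 (p. 110)] -/
@[reassoc]
theorem toTwist_naturality (x : K) :
    toTwist g τ hτ F x ≫ (Scheme.Modules.pullback (τ x)).map φ =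
      (Scheme.Modules.pullback g).map ((Scheme.Modules.pushforward g).map φ) ≫ toTwist g τ hτ F' x := by
  have h := (toTwistNatTrans g τ hτ x).naturality φ
  simp only [toTwistNatTrans_app, CategoryTheory.Functor.comp_map] at h
  exact h.symm

/-- **`toPi` is natural in `F`**: for `φ : F ⟶ F'`, `toPi … F ≫ ∏_x (τ x)^*φ = g^*g_*φ ≫ toPi … F'`.
[cite: Hartshorne1977, II.5 (p. 110)] -/
@[reassoc]
theorem toPi_naturality :
    toPi g τ hτ F ≫ Limits.Pi.map (fun x => (Scheme.Modules.pullback (τ x)).map φ) =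
      (Scheme.Modules.pullback g).map ((Scheme.Modules.pushforward g).map φ) ≫ toPi g τ hτ F' := by
  refine Limits.Pi.hom_ext _ _ fun x => ?_
  simp only [toPi, Category.assoc, Limits.Pi.map_π, Limits.Pi.lift_π_assoc, Limits.Pi.lift_π, toTwist_naturality]

end Naturality

/-! ## §2 The functor `F ↦ ∏_x (τ x)^* F` and `toPi` as a natural transformation -/

/-- **The functor `F ↦ ∏_x (τ x)^*F`** (product of the pull-backs along the self-maps `τ x`).
[cite: Hartshorne1977, II.5 (p. 110) and II Ex. 1.9 (p. 66)] -/
def piPullback : X.Modules ⥤ X.Modules where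
  obj F := ∏ᶜ fun x => (Scheme.Modules.pullback (τ x)).obj F
  map φ := Limits.Pi.map fun x => (Scheme.Modules.pullback (τ x)).map φ
  map_id F := Limits.Pi.hom_ext _ _ fun x => by
    simp only [Limits.Pi.map_π, CategoryTheory.Functor.map_id, Category.comp_id, Category.id_comp]
  map_comp φ ψ := Limits.Pi.hom_ext _ _ fun x => by
    simp only [Limits.Pi.map_π, Limits.Pi.map_π_assoc, CategoryTheory.Functor.map_comp, Category.assoc]

/-- The terms of `piPullback` (definitional). [cite: Hartshorne1977, II.5 (p. 110)] -/
@[simp]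
theorem piPullback_obj (F : X.Modules) :
    (piPullback τ).obj F = ∏ᶜ fun x => (Scheme.Modules.pullback (τ x)).obj F := rfl

/-- The action of `piPullback` on morphisms (definitional). [cite: Hartshorne1977, II.5 (p. 110)] -/
@[simp]
theorem piPullback_map {F F' : X.Modules} (φ : F ⟶ F') :
    (piPullback τ).map φ = Limits.Pi.map fun x => (Scheme.Modules.pullback (τ x)).map φ := rfl

/-- **`toPi` as a natural transformation `g_* ⋙ g^* ⟶ (F ↦ ∏_x (τ x)^*F)`**. [cite: Hartshorne1977, II.5 (p. 110)] -/
def toPiNatTrans : Scheme.Modules.pushforward g ⋙ Scheme.Modules.pullback g ⟶ piPullback τ where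
  app F := toPi g τ hτ F
  naturality _ _ φ := (toPi_naturality g τ hτ φ).symm

/-- The components of `toPiNatTrans` are the `toPi` (definitional). [cite: Hartshorne1977, II.5 (p. 110)] -/
@[simp]
theorem toPiNatTrans_app (F : X.Modules) : (toPiNatTrans g τ hτ).app F = toPi g τ hτ F := rfl

/-- If every `toPi … F` is an isomorphism, `toPiNatTrans` is a natural isomorphism `g_* ⋙ g^* ≅ piPullback τ`.
[cite: Hartshorne1977, II.5 (p. 110)] -/
theorem isIso_toPiNatTrans (h : ∀ F : X.Modules, IsIso (toPi g τ hτ F)) : IsIso (toPiNatTrans g τ hτ) := by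
  haveI : ∀ F : X.Modules, IsIso ((toPiNatTrans g τ hτ).app F) := fun F => h F
  exact NatIso.isIso_of_isIso_app (toPiNatTrans g τ hτ)

/-! ## §3 Complex level: `g^* g_* E• ⟶ ∏_x (τ x)^* E•` termwise -/

section Complex

variable {ι : Type*} {c : ComplexShape ι} (E : HomologicalComplex X.Modules c)

/-- **`toTwist` termwise on a complex**: `g^*g_*E• ⟶ (τ x)^*E•`, a morphism of complexes because `toTwist` is natural
(`toTwist_naturality` applied to the differentials). [cite: Hartshorne1977, II.5 (p. 110)] [cite: MumfordAV1970, §7 Thm. 4 p. 72] -/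
def toTwistComplex (x : K) :
    ((Scheme.Modules.pullback g).mapHomologicalComplex c).obj
        (((Scheme.Modules.pushforward g).mapHomologicalComplex c).obj E) ⟶
      ((Scheme.Modules.pullback (τ x)).mapHomologicalComplex c).obj E where
  f i := toTwist g τ hτ (E.X i) x
  comm' i j _ := by
    simp only [CategoryTheory.Functor.mapHomologicalComplex_obj_d]
    exact toTwist_naturality g τ hτ (E.d i j) x

/-- The components of `toTwistComplex` (definitional). [cite: Hartshorne1977, II.5 (p. 110)] -/
@[simp]
theorem toTwistComplex_f (x : K) (i : ι) : (toTwistComplex g τ hτ E x).f i = toTwist g τ hτ (E.X i) x := rfl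

/-- **`toPiComplex : g^*g_*E• ⟶ ∏_x (τ x)^*E•`** — the tuple of the `toTwistComplex … x`, the product being taken in the
category of complexes. [cite: Hartshorne1977, II.5 (p. 110)] [cite: MumfordAV1970, §7 Thm. 4 p. 72] -/
def toPiComplex :
    ((Scheme.Modules.pullback g).mapHomologicalComplex c).obj
        (((Scheme.Modules.pushforward g).mapHomologicalComplex c).obj E) ⟶
      ∏ᶜ fun x => ((Scheme.Modules.pullback (τ x)).mapHomologicalComplex c).obj E :=
  Pi.lift (toTwistComplex g τ hτ E)

/-- The `x`-component of `toPiComplex` is `toTwistComplex … x`. [cite: Hartshorne1977, II.5 (p. 110)] -/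
@[reassoc (attr := simp)]
theorem toPiComplex_π (x : K) : toPiComplex g τ hτ E ≫ Pi.π _ x = toTwistComplex g τ hτ E x := Pi.lift_π _ _

/-- **The degree-`i` part of `toPiComplex` is `toPi … (E.X i)`**, up to the canonical identification
`(∏_x (τ x)^*E•)^i ≅ ∏_x (τ x)^*(Eⁱ)` (limits of complexes are computed degreewise). [cite: Hartshorne1977, II.5 (p. 110)] -/
theorem toPiComplex_f (i : ι) :
    (toPiComplex g τ hτ E).f i ≫
        (PreservesProduct.iso (HomologicalComplex.eval X.Modules c i)
          (fun x => ((Scheme.Modules.pullback (τ x)).mapHomologicalComplex c).obj E)).hom =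
      toPi g τ hτ (E.X i) := by
  rw [PreservesProduct.iso_hom]
  have h := map_lift_piComparison (HomologicalComplex.eval X.Modules c i)
    (fun x => ((Scheme.Modules.pullback (τ x)).mapHomologicalComplex c).obj E) _ (toTwistComplex g τ hτ E)
  simp only [HomologicalComplex.eval_map, toTwistComplex_f] at h
  exact h

/-- **Termwise isomorphism ⇒ isomorphism of complexes**: if every `toPi … (Eⁱ)` is an isomorphism then so is
`toPiComplex … E•`. [cite: Hartshorne1977, II.5 (p. 110)] [cite: MumfordAV1970, §7 Thm. 4 p. 72] -/
theorem isIso_toPiComplex_of_isIso_toPi (h : ∀ i, IsIso (toPi g τ hτ (E.X i))) : IsIso (toPiComplex g τ hτ E) := by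
  haveI : ∀ i, IsIso ((toPiComplex g τ hτ E).f i) := fun i => by
    haveI := h i
    rw [(Iso.eq_comp_inv _).mpr (toPiComplex_f g τ hτ E i)]
    exact @IsIso.comp_isIso _ _ _ _ _ _ _ (h i) inferInstance
  exact HomologicalComplex.Hom.isIso_of_components _

/-- **`g^*g_*E• ≅ ∐_x (τ x)^*E•` as complexes** when `K` is finite and every `toPi … (Eⁱ)` is an isomorphism (finite products of
complexes of `𝒪_X`-modules are biproducts) — the complex-level shape of Mumford's `π^*π_*F ≅ ⊕_x T_x^*F`.
[cite: MumfordAV1970, §7 Thm. 4 p. 72] [cite: Hartshorne1977, II.5 (p. 110)] -/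
theorem nonempty_pullback_pushforward_complex_iso_sigma [Finite K] (h : ∀ i, IsIso (toPi g τ hτ (E.X i))) :
    Nonempty (((Scheme.Modules.pullback g).mapHomologicalComplex c).obj
        (((Scheme.Modules.pushforward g).mapHomologicalComplex c).obj E) ≅
      ∐ fun x => ((Scheme.Modules.pullback (τ x)).mapHomologicalComplex c).obj E) := by
  haveI : HasFiniteBiproducts (HomologicalComplex X.Modules c) := HasFiniteBiproducts.of_hasFiniteProducts
  haveI := isIso_toPiComplex_of_isIso_toPi g τ hτ E h
  exact ⟨asIso (toPiComplex g τ hτ E) ≪≫ (biproduct.isoProduct _).symm ≪≫ biproduct.isoCoproduct _⟩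

end Complex

end Literature.AlgebraicGeometry.Modules

end
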